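import Summits.Ventures.HodgeRepro.FaceCensusEngine
import Summits.Ventures.HodgeRepro.EngineMasks
import Summits.Ventures.HodgeRepro.EngineNormalize

/-!
# EngineOrbits — the twist action on type sets and the semantics of `squareOrbitRepsFast` (seat p4)

The Galois twist `twistSet j` is a right action of `G` on normalised type sets; squares are closed under it;
`squareOrbitRepsFast rs = true` says that the orbits of the `square r`, `r ∈ rs`, partition `Γ.squares`, so that
`Γ.squares.length = Σ_{r ∈ rs} Γ.orbitSize (square r)` (`squares_length_eq_sum_map`) and every square lies in the
orbit of exactly one representative (`existsUnique_rep`).  The twist of a face `(T, p, q)` is written out as `(Γ.twist j T, Γ.twist j p, Γ.twist j q)` and the orbit of a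
type set as the finset `((List.finRange n).map fun j => Γ.twistSet j S).toFinset` (kit v4: no auxiliary definitions,
every file of the kit is a pure proof file).
-/

namespace Summit.Ventures.HodgeRepro.FaceCensus

namespace CMGaloisType

variable {n : ℕ} (Γ : CMGaloisType n)

/-! ### The twist is a right action -/

/-- Right multiplication by a fixed element is surjective (finite group table). -/
theorem mul_right_surjective (hΓ : Γ.isCMGaloisType = true) (j : Fin n) : Function.Surjective fun i => Γ.mul i j :=
  Finite.injective_iff_surjective.1 ((IsGroupTable.mul_right_injective hΓ) j)

/-- A twist is a mask below `2 ^ n`. -/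
theorem twist_lt (j : Fin n) (T : ℕ) : Γ.twist j T < 2 ^ n := imageMask_lt _ _

/-- Twisting by `k` then by `j` is twisting by `k * j` (the twist is a right action). -/
theorem twist_twist (hΓ : Γ.isCMGaloisType = true) (j k : Fin n) (T : ℕ) :
    Γ.twist j (Γ.twist k T) = Γ.twist (Γ.mul k j) T := by
  apply eq_of_mem_eq (Γ.twist_lt _ _) (Γ.twist_lt _ _)
  intro x
  obtain ⟨i, hi⟩ := Γ.mul_right_surjective hΓ (Γ.mul k j) x
  simp only at hi
  rw [← hi, Γ.mem_twist hΓ, ← (IsGroupTable.mul_assoc hΓ), Γ.mem_twist hΓ, Γ.mem_twist hΓ]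

/-- Twisting by the identity is the identity on masks below `2 ^ n`. -/
theorem twist_one (hΓ : Γ.isCMGaloisType = true) (T : ℕ) (hT : T < 2 ^ n) : Γ.twist Γ.one T = T := by
  apply eq_of_mem_eq (Γ.twist_lt _ _) hT
  intro x
  have := Γ.mem_twist hΓ Γ.one T x
  rwa [(IsGroupTable.mul_one hΓ)] at this

/-- A twist is injective on masks below `2 ^ n`. -/
theorem twist_injective (hΓ : Γ.isCMGaloisType = true) (j : Fin n) {S T : ℕ} (hS : S < 2 ^ n) (hT : T < 2 ^ n)
    (h : Γ.twist j S = Γ.twist j T) : S = T := by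
  obtain ⟨j', hj'⟩ := (IsGroupTable.exists_right_inv hΓ) j
  have := congrArg (Γ.twist j') h
  rwa [Γ.twist_twist hΓ, Γ.twist_twist hΓ, hj', Γ.twist_one hΓ S hS, Γ.twist_one hΓ T hT] at this

/-- Membership in `twistSet j S`: the twists by `j` of the members of `S`. -/
theorem mem_twistSet (j : Fin n) (S : List ℕ) (x : ℕ) :
    x ∈ Γ.twistSet j S ↔ ∃ y ∈ S, Γ.twist j y = x := by
  simp [twistSet, mem_normalize, List.mem_map]

/-- `twistSet` is a right action on type sets: `twistSet j (twistSet k S) = twistSet (k * j) S`. -/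
theorem twistSet_twistSet (hΓ : Γ.isCMGaloisType = true) (j k : Fin n) (S : List ℕ) :
    Γ.twistSet j (Γ.twistSet k S) = Γ.twistSet (Γ.mul k j) S := by
  unfold twistSet
  rw [normalize_eq_iff]
  intro x
  simp only [List.mem_map, mem_normalize]
  constructor
  · rintro ⟨y, ⟨z, hz, rfl⟩, rfl⟩
    exact ⟨z, hz, (Γ.twist_twist hΓ j k z).symm⟩
  · rintro ⟨z, hz, rfl⟩
    exact ⟨Γ.twist k z, ⟨z, hz, rfl⟩, Γ.twist_twist hΓ j k z⟩

/-- Twisting a type set by the identity normalises it. -/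
theorem twistSet_one (hΓ : Γ.isCMGaloisType = true) (S : List ℕ) (hS : ∀ x ∈ S, x < 2 ^ n) :
    Γ.twistSet Γ.one S = normalize S := by
  unfold twistSet
  rw [normalize_eq_iff]
  intro x
  simp only [List.mem_map]
  constructor
  · rintro ⟨y, hy, rfl⟩
    rw [Γ.twist_one hΓ y (hS y hy)]
    exact hy
  · intro hx
    exact ⟨x, hx, Γ.twist_one hΓ x (hS x hx)⟩

/-- A twisted type set is strictly increasing (it is normalised). -/
theorem twistSet_pairwise_lt (j : Fin n) (S : List ℕ) : (Γ.twistSet j S).Pairwise (· < ·) :=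
  normalize_pairwise_lt _

/-- The members of a twisted type set are below `2 ^ n`. -/
theorem twistSet_lt (j : Fin n) (S : List ℕ) : ∀ x ∈ Γ.twistSet j S, x < 2 ^ n := by
  intro x hx
  obtain ⟨y, -, rfl⟩ := (Γ.mem_twistSet j S x).1 hx
  exact Γ.twist_lt j y

/-- `twistSet j` is invertible on normalised sets of masks below `2 ^ n`. -/
theorem twistSet_inv (hΓ : Γ.isCMGaloisType = true) (j : Fin n) (S : List ℕ) (hS : S.Pairwise (· < ·))
    (hS' : ∀ x ∈ S, x < 2 ^ n) : ∃ j', Γ.twistSet j' (Γ.twistSet j S) = S := by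
  obtain ⟨j', hj'⟩ := (IsGroupTable.exists_right_inv hΓ) j
  exact ⟨j', by rw [Γ.twistSet_twistSet hΓ, hj', Γ.twistSet_one hΓ S hS', normalize_eq_self_of_pairwise_lt hS]⟩

/-! ### Squares are closed under the twist -/

/-- A twist commutes with a flip: `twist j (flipAt p T) = flipAt (twist j p) (twist j T)`. -/
theorem twist_flipAt (hΓ : Γ.isCMGaloisType = true) (j : Fin n) (p T : ℕ) :
    Γ.twist j (flipAt p T) = flipAt (Γ.twist j p) (Γ.twist j T) := by
  apply eq_of_mem_eq (Γ.twist_lt _ _) (flipAt_lt (Γ.twist_lt _ _) (Γ.twist_lt _ _))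
  intro x
  obtain ⟨i, hi⟩ := Γ.mul_right_surjective hΓ j x
  simp only at hi
  rw [← hi, Γ.mem_twist hΓ, mem_flipAt, mem_flipAt, Γ.mem_twist hΓ, Γ.mem_twist hΓ]

/-- The twist by `j` of the place of `a` is the place of `a * j`. -/
theorem twist_placeMask (hΓ : Γ.isCMGaloisType = true) (j a : Fin n) :
    Γ.twist j (Γ.placeMask a) = Γ.placeMask (Γ.mul a j) := by
  apply eq_of_mem_eq (Γ.twist_lt _ _) (Γ.placeMask_lt _)
  intro x
  obtain ⟨i, hi⟩ := Γ.mul_right_surjective hΓ j x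
  simp only at hi
  rw [← hi, Γ.mem_twist hΓ, Γ.mem_placeMask, Γ.mem_placeMask, ← (IsGroupTable.mul_assoc hΓ)]
  have key : ∀ y : Fin n, decide (Γ.mul i j = Γ.mul y j) = decide (i = y) := fun y => by
    rw [decide_eq_decide]
    exact ((IsGroupTable.mul_right_injective hΓ) j).eq_iff
  rw [key, key]

/-- A twist of a CM type is a CM type. -/
theorem isCMType_twist (hΓ : Γ.isCMGaloisType = true) {T : ℕ} (hT : Γ.isCMType T = true) (j : Fin n) :
    Γ.isCMType (Γ.twist j T) = true := by
  rw [Γ.isCMType_iff]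
  refine ⟨Γ.twist_lt _ _, fun x => ?_⟩
  obtain ⟨i, hi⟩ := Γ.mul_right_surjective hΓ j x
  simp only at hi
  rw [← hi, ← (IsGroupTable.mul_assoc hΓ), Γ.mem_twist hΓ, Γ.mem_twist hΓ, Γ.mem_conj_of_isCMType hT]

/-- The twist of a face is a face. -/
theorem twistFace_mem_faces (hΓ : Γ.isCMGaloisType = true) (j : Fin n) {f : ℕ × ℕ × ℕ} (hf : f ∈ Γ.faces) :
    (Γ.twist j f.1, Γ.twist j f.2.1, Γ.twist j f.2.2) ∈ Γ.faces := by
  obtain ⟨T, p, q⟩ := f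
  rw [Γ.mem_faces] at hf ⊢
  obtain ⟨hT, hp, hq, hqp⟩ := hf
  rw [Γ.mem_cmTypes] at hT
  obtain ⟨a, rfl⟩ := (Γ.mem_places p).1 hp
  obtain ⟨b, rfl⟩ := (Γ.mem_places q).1 hq
  refine ⟨(Γ.mem_cmTypes _).2 (Γ.isCMType_twist hΓ hT j), ?_, ?_, ?_⟩
  · exact (Γ.mem_places _).2 ⟨Γ.mul a j, Γ.twist_placeMask hΓ j a⟩
  · exact (Γ.mem_places _).2 ⟨Γ.mul b j, Γ.twist_placeMask hΓ j b⟩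
  · intro h
    exact hqp (Γ.twist_injective hΓ j (Γ.placeMask_lt b) (Γ.placeMask_lt a) h)

/-- Membership in the type square of a face: the four corners `T`, `T^{(p)}`, `T^{(q)}`, `T^{(pq)}`. -/
theorem mem_square (f : ℕ × ℕ × ℕ) (x : ℕ) :
    x ∈ square f ↔ x = f.1 ∨ x = flipAt f.2.1 f.1 ∨ x = flipAt f.2.2 f.1 ∨ x = flipAt f.2.2 (flipAt f.2.1 f.1) := by
  simp [square, mem_normalize]

/-- The square of a twisted face is the twist of its square. -/
theorem square_twistFace (hΓ : Γ.isCMGaloisType = true) (j : Fin n) (f : ℕ × ℕ × ℕ) :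
    square ((Γ.twist j f.1, Γ.twist j f.2.1, Γ.twist j f.2.2)) = Γ.twistSet j (square f) := by
  obtain ⟨T, p, q⟩ := f
  simp only [square, twistSet]
  rw [normalize_eq_iff]
  intro x
  simp only [List.mem_map, mem_normalize, List.mem_cons, List.not_mem_nil, or_false]
  constructor
  · rintro (rfl | rfl | rfl | rfl)
    · exact ⟨T, Or.inl rfl, rfl⟩
    · exact ⟨flipAt p T, Or.inr (Or.inl rfl), Γ.twist_flipAt hΓ j p T⟩
    · exact ⟨flipAt q T, Or.inr (Or.inr (Or.inl rfl)), Γ.twist_flipAt hΓ j q T⟩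
    · exact ⟨flipAt q (flipAt p T), Or.inr (Or.inr (Or.inr rfl)), by
        rw [Γ.twist_flipAt hΓ, Γ.twist_flipAt hΓ]⟩
  · rintro ⟨y, (rfl | rfl | rfl | rfl), rfl⟩
    · exact Or.inl rfl
    · exact Or.inr (Or.inl (Γ.twist_flipAt hΓ j p T))
    · exact Or.inr (Or.inr (Or.inl (Γ.twist_flipAt hΓ j q T)))
    · exact Or.inr (Or.inr (Or.inr (by rw [Γ.twist_flipAt hΓ, Γ.twist_flipAt hΓ])))

/-- Membership in `squares`: the squares of the faces. -/
theorem mem_squares (S : List ℕ) : S ∈ Γ.squares ↔ ∃ f ∈ Γ.faces, square f = S := by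
  simp [squares, List.mem_eraseDups, List.mem_map]

/-- Squares are closed under twists. -/
theorem twistSet_mem_squares (hΓ : Γ.isCMGaloisType = true) (j : Fin n) {S : List ℕ} (hS : S ∈ Γ.squares) :
    Γ.twistSet j S ∈ Γ.squares := by
  obtain ⟨f, hf, rfl⟩ := (Γ.mem_squares S).1 hS
  exact (Γ.mem_squares _).2 ⟨(Γ.twist j f.1, Γ.twist j f.2.1, Γ.twist j f.2.2), Γ.twistFace_mem_faces hΓ j hf, Γ.square_twistFace hΓ j f⟩

/-- A square is strictly increasing (it is normalised). -/
theorem square_pairwise_lt (f : ℕ × ℕ × ℕ) : (square f).Pairwise (· < ·) := normalize_pairwise_lt _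

/-- The members of the square of a face are below `2 ^ n`. -/
theorem square_lt {f : ℕ × ℕ × ℕ} (hf : f ∈ Γ.faces) : ∀ x ∈ square f, x < 2 ^ n := by
  obtain ⟨T, p, q⟩ := f
  rw [Γ.mem_faces] at hf
  obtain ⟨hT, hp, hq, -⟩ := hf
  rw [Γ.mem_cmTypes] at hT
  obtain ⟨a, rfl⟩ := (Γ.mem_places p).1 hp
  obtain ⟨b, rfl⟩ := (Γ.mem_places q).1 hq
  have hT' := Γ.lt_of_isCMType hT
  intro x hx
  rw [mem_square] at hx
  rcases hx with rfl | rfl | rfl | rfl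
  · exact hT'
  · exact flipAt_lt (Γ.placeMask_lt a) hT'
  · exact flipAt_lt (Γ.placeMask_lt b) hT'
  · exact flipAt_lt (Γ.placeMask_lt b) (flipAt_lt (Γ.placeMask_lt a) hT')

/-! ### Semantics of `squareOrbitRepsFast` -/

/-- Membership in `repSquareTwists rs`: the pairs (twist of the square of `rs[a]`, `a`). -/
theorem mem_repSquareTwists (rs : List (ℕ × ℕ × ℕ)) (p : List ℕ × ℕ) :
    p ∈ Γ.repSquareTwists rs ↔ ∃ (h : p.2 < rs.length) (j : Fin n), p.1 = Γ.twistSet j (square rs[p.2]) := by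
  obtain ⟨S, a⟩ := p
  simp only [repSquareTwists, List.mem_flatMap, List.mem_map, List.mem_finRange, true_and, Prod.mk.injEq]
  constructor
  · rintro ⟨⟨r, b⟩, hr, j, rfl, rfl⟩
    rw [List.mem_zipIdx_iff_getElem?] at hr
    simp only at hr
    have hb : b < rs.length := by
      by_contra hlt
      rw [List.getElem?_eq_none (not_lt.1 hlt)] at hr
      simp at hr
    refine ⟨hb, j, ?_⟩
    rw [List.getElem?_eq_getElem hb, Option.some.injEq] at hr
    rw [hr]
  · rintro ⟨ha, j, hS⟩
    refine ⟨⟨rs[a], a⟩, ?_, j, hS.symm, rfl⟩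
    rw [List.mem_zipIdx_iff_getElem?]
    exact List.getElem?_eq_getElem ha

/-- The three clauses of `squareOrbitRepsFast rs = true`. -/
theorem squareOrbitRepsFast_iff (rs : List (ℕ × ℕ × ℕ)) :
    Γ.squareOrbitRepsFast rs = true ↔
      (∀ S ∈ Γ.squares, ∃ (a : ℕ) (h : a < rs.length) (j : Fin n), Γ.twistSet j (square rs[a]) = S) ∧
      (∀ r ∈ rs, r ∈ Γ.faces) ∧
      (∀ (a b : ℕ) (ha : a < rs.length) (hb : b < rs.length) (j : Fin n),
        Γ.twistSet j (square rs[a]) = square rs[b] → a = b) := by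
  simp only [squareOrbitRepsFast, Bool.and_eq_true, List.all_eq_true, List.any_eq_true, beq_iff_eq,
    List.contains_iff_mem, Bool.or_eq_true, Bool.not_eq_eq_eq_not, Bool.not_true, beq_eq_false_iff_ne, ne_eq]
  constructor
  · rintro ⟨⟨h1, h2⟩, h3⟩
    refine ⟨fun S hS => ?_, h2, fun a b ha hb j hj => ?_⟩
    · obtain ⟨p, hp, hpS⟩ := h1 S hS
      rw [Γ.mem_repSquareTwists] at hp
      obtain ⟨hlt, j, hpj⟩ := hp
      exact ⟨p.2, hlt, j, by rw [← hpj, hpS]⟩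
    · have hmem : (rs[b], b) ∈ rs.zipIdx := by
        rw [List.mem_zipIdx_iff_getElem?]
        exact List.getElem?_eq_getElem hb
      have := h3 (rs[b], b) hmem (Γ.twistSet j (square rs[a]), a)
        ((Γ.mem_repSquareTwists rs _).2 ⟨ha, j, rfl⟩)
      simp only at this
      rcases this with h | h
      · exact (h hj).elim
      · exact h
  · rintro ⟨h1, h2, h3⟩
    refine ⟨⟨fun S hS => ?_, h2⟩, fun ri hri p hp => ?_⟩
    · obtain ⟨a, ha, j, hj⟩ := h1 S hS
      exact ⟨(Γ.twistSet j (square rs[a]), a), (Γ.mem_repSquareTwists rs _).2 ⟨ha, j, rfl⟩, hj⟩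
    · rw [Γ.mem_repSquareTwists] at hp
      obtain ⟨ha, j, hpj⟩ := hp
      rw [List.mem_zipIdx_iff_getElem?] at hri
      have hb : ri.2 < rs.length := by
        by_contra hlt
        rw [List.getElem?_eq_none (not_lt.1 hlt)] at hri
        simp at hri
      rw [List.getElem?_eq_getElem hb, Option.some.injEq] at hri
      by_cases heq : p.1 = square ri.1
      · right
        rw [hpj, ← hri] at heq
        exact h3 _ _ ha hb j heq
      · left
        exact heq

/-! ### The orbits of the representatives partition the squares -/

/-- `orbitSize S` is the cardinality of the orbit finset of `S`. -/
theorem orbitSize_eq_card (S : List ℕ) : Γ.orbitSize S = (((List.finRange n).map fun j => Γ.twistSet j S).toFinset).card := by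
  unfold orbitSize
  exact length_eraseDups_eq_card ((List.finRange n).map fun j => Γ.twistSet j S)

/-- Membership in the orbit finset of `S`: the twists of `S`. -/
theorem mem_orbitFinset (S S' : List ℕ) : S' ∈ ((List.finRange n).map fun j => Γ.twistSet j S).toFinset ↔ ∃ j, Γ.twistSet j S = S' := by
  simp [List.mem_finRange]

/-- `squares` has no duplicates. -/
theorem squares_nodup : Γ.squares.Nodup := eraseDups_nodup _

/-- The length of `squares` is the cardinality of its finset. -/
theorem squares_length_eq_card : Γ.squares.length = Γ.squares.toFinset.card :=
  (List.toFinset_card_of_nodup Γ.squares_nodup).symm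

/-- If `rs` is accepted by `squareOrbitRepsFast`, the squares are the union of the orbits of the representatives' squares. -/
theorem squares_toFinset_eq_biUnion (hΓ : Γ.isCMGaloisType = true) (rs : List (ℕ × ℕ × ℕ))
    (h : Γ.squareOrbitRepsFast rs = true) :
    Γ.squares.toFinset =
      (Finset.univ : Finset (Fin rs.length)).biUnion fun a => ((List.finRange n).map fun j => Γ.twistSet j (square rs[a])).toFinset := by
  obtain ⟨h1, h2, -⟩ := (Γ.squareOrbitRepsFast_iff rs).1 h
  ext S
  simp only [List.mem_toFinset, Finset.mem_biUnion, Finset.mem_univ, true_and, Γ.mem_orbitFinset]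
  constructor
  · intro hS
    obtain ⟨a, ha, j, hj⟩ := h1 S hS
    exact ⟨⟨a, ha⟩, j, hj⟩
  · rintro ⟨a, j, rfl⟩
    exact Γ.twistSet_mem_squares hΓ j ((Γ.mem_squares _).2 ⟨rs[a], h2 _ (List.getElem_mem _), rfl⟩)

/-- If `rs` is accepted by `squareOrbitRepsFast`, the orbits of the representatives' squares are pairwise disjoint. -/
theorem orbits_pairwiseDisjoint (hΓ : Γ.isCMGaloisType = true) (rs : List (ℕ × ℕ × ℕ))
    (h : Γ.squareOrbitRepsFast rs = true) :
    ((Finset.univ : Finset (Fin rs.length)) : Set (Fin rs.length)).PairwiseDisjoint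
      fun a => ((List.finRange n).map fun j => Γ.twistSet j (square rs[a])).toFinset := by
  obtain ⟨-, h2, h3⟩ := (Γ.squareOrbitRepsFast_iff rs).1 h
  intro a _ b _ hab
  show Disjoint (((List.finRange n).map fun j => Γ.twistSet j (square rs[a])).toFinset) (((List.finRange n).map fun j => Γ.twistSet j (square rs[b])).toFinset)
  rw [Finset.disjoint_left]
  intro S hSa hSb
  rw [Γ.mem_orbitFinset] at hSa hSb
  obtain ⟨j, rfl⟩ := hSa
  obtain ⟨k, hk⟩ := hSb
  have hfb : rs[b] ∈ Γ.faces := h2 _ (List.getElem_mem _)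
  obtain ⟨k', hk'⟩ := Γ.twistSet_inv hΓ k (square rs[b]) (square_pairwise_lt _) (Γ.square_lt hfb)
  have key : Γ.twistSet (Γ.mul j k') (square rs[a]) = square rs[b] := by
    rw [← Γ.twistSet_twistSet hΓ, ← hk, hk']
  exact hab (Fin.ext (h3 a b a.2 b.2 _ key))

/-- **Orbit census.** If `rs` is accepted by `squareOrbitRepsFast`, the number of type squares is the sum of
the orbit sizes of the representatives' squares. -/
theorem squares_length_eq_sum (hΓ : Γ.isCMGaloisType = true) (rs : List (ℕ × ℕ × ℕ))
    (h : Γ.squareOrbitRepsFast rs = true) :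
    Γ.squares.length = ∑ a : Fin rs.length, Γ.orbitSize (square rs[a]) := by
  rw [Γ.squares_length_eq_card, Γ.squares_toFinset_eq_biUnion hΓ rs h,
    Finset.card_biUnion (Γ.orbits_pairwiseDisjoint hΓ rs h)]
  simp only [orbitSize_eq_card]

/-- The sum of `f` over a list as a sum over its indices. -/
theorem sum_map_eq_sum_fin {α : Type*} (l : List α) (f : α → ℕ) :
    (l.map f).sum = ∑ a : Fin l.length, f l[a] := by
  rw [← List.sum_ofFn]
  congr 1
  have : (List.ofFn fun a : Fin l.length => f l[a]) = (List.ofFn fun a : Fin l.length => l[a]).map f := by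
    rw [List.map_ofFn]
    rfl
  rw [this]
  congr 1
  exact (List.ofFn_getElem (xs := l)).symm

/-- **Orbit census, list form**: `squares.length` is the sum over `rs` of the orbit sizes — the clause `(reps.map orbitSize ∘ square)` of every census row adds up to `squares.length`. -/
theorem squares_length_eq_sum_map (hΓ : Γ.isCMGaloisType = true) (rs : List (ℕ × ℕ × ℕ))
    (h : Γ.squareOrbitRepsFast rs = true) :
    Γ.squares.length = (rs.map fun r => Γ.orbitSize (square r)).sum := by
  rw [sum_map_eq_sum_fin]
  exact Γ.squares_length_eq_sum hΓ rs h

/-- Every square lies in the orbit of exactly one representative. -/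
theorem existsUnique_rep (hΓ : Γ.isCMGaloisType = true) (rs : List (ℕ × ℕ × ℕ))
    (h : Γ.squareOrbitRepsFast rs = true) {S : List ℕ} (hS : S ∈ Γ.squares) :
    ∃! a : Fin rs.length, S ∈ ((List.finRange n).map fun j => Γ.twistSet j (square rs[a])).toFinset := by
  have hmem : S ∈ Γ.squares.toFinset := List.mem_toFinset.2 hS
  rw [Γ.squares_toFinset_eq_biUnion hΓ rs h, Finset.mem_biUnion] at hmem
  obtain ⟨a, -, ha⟩ := hmem
  refine ⟨a, ha, fun b hb => ?_⟩
  by_contra hab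
  exact Finset.disjoint_left.1 (Γ.orbits_pairwiseDisjoint hΓ rs h (Finset.mem_univ b) (Finset.mem_univ a) hab) hb ha

end CMGaloisType

end Summit.Ventures.HodgeRepro.FaceCensus
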